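import Summits.HodgeConjecture.HodgeConjecture.Theorems.NikulinTwinTransportNikulinSerreCarrierAnchorFrameLinearAlgebra
import Summits.HodgeConjecture.HodgeConjecture.Theorems.NikulinTwinTransportNikulinSerreCarrierAnchorFrameEightFrame
import Summits.HodgeConjecture.HodgeConjecture.Theorems.NikulinTwinTransportTwinSimilitudeAlgebraicMarkings
import Literature.AlgebraicGeometry.Surfaces.K3Marking

/-!
# Crux `NikulinSerreCarrier` · line `neron-severi-intertwiner` · stub `stub_nikulinAnchorFrame` (S1) —
# THE COMPLETED NIKULIN SIMILITUDE ON THE SUMMIT CARRIER, from the quotient correspondence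

Conditional CORE PIECE (`--supports stmt-HodgeConjecture-14464`) of the anchor stub `stub_nikulinAnchorFrame`
(skeleton `Cruxes/NikulinSerreCarrier/Lines/neron-severi-intertwiner.lean`, fields `hp`, `hΨ`,
`antiInvariant_from_divisors` of `AnchorFrame`). The anchor's similitude `Ψ : H²(Y′(ℂ); ℂ) → H²(X(ℂ); ℂ)`
is `Ψ = g^* ⊕ (N_j ↦ r_j)`: `g^* = β_*π^*` the degree-two quotient correspondence of the Nikulin
involution `ι` (van Geemen–Sarti 2007 §1.4–1.8, Prop. 2.5: "`β_*π^* : H²(Y,ℚ) → H²(X,ℚ)` … satisfies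
`(β_*π^*x)(β_*π^*y) = 2xy` for `x, y ∈ V_Y`"), COMPLETED on the span of the eight nodal classes `N_j` of
`Y′ = \widetilde{X/ι}` by the `A₁⁸` frame `r_j` of the anti-invariant lattice `E₈(−2) ⊂ NS(X)` (route item
`EEightTwoSimilitude`, proved; sibling `…AnchorFrameEightFrame`).

`exists_completedNikulinSimilitude`: for projective K3 surfaces `X, Y`, a Nikulin involution `ι` of `X`,
marked integral generators `p, p'` of `H⁴` (each carried by some marking `H² ≅ Λ_ℂ`, which pins it to the
orientation class), and DATA `N : Fin 8 → H²(Y(ℂ); ℂ)`, `G : H²(Y(ℂ); ℂ) →ₗ H²(X(ℂ); ℂ)` subject to the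
printed identities of the Nikulin quotient — `N_j` integral, algebraic, of type `(1,1)`, `N_i ∪ N_j = −2δ_ij p'`;
`G` rational, type-preserving, `ι^*`-invariant image, `(Gx ∪ Gy) = 2(x ∪ y)` for `x, y ∈ N^⊥` — there is
(GRANTED the named facts `Nikulin_involution_marking`, `Huybrechts_K3_marking_exists`,
`Huybrechts_K3_hodgeTypes_H2`) a `ℂ`-linear `Ψ` which is RATIONAL, TYPE-PRESERVING and a `2`-SIMILITUDE
(`(x ∪ y) = a p' ⟹ (Ψx ∪ Ψy) = 2a p`, verbatim the clause `IsRationalHodgeTwoSimilitude` of the skeleton),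
equal to `G` on `N^⊥`, with `Ψ N_j = r_j` an integral anti-invariant `(−4)`-frame, and such that EVERY
`ι^*`-ANTI-INVARIANT CLASS IS `Ψ` OF AN ALGEBRAIC divisor-supported class of `Y` (the skeleton's
`antiInvariant_from_divisors`). The linear algebra is the sibling `…AnchorFrameLinearAlgebra`
(`bilin_map_map_of_formula` etc.); this file does the K3 bookkeeping: cup forms through markings, the
agreement of marked generators (`generator_eq_of_markings`: `Λ_{K3}` has no rational anti-isometry), the
Hodge types of `H²(K3)` (`Huybrechts_K3_hodgeTypes_H2`), rationality through `Λ_ℚ`.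

What this does NOT supply (reported to the line lead as the stub's open facts): the EXISTENCE of
`(X, ι)` (van Geemen–Sarti Prop. 2.3), of the resolved quotient `Y′` with its nodal classes and of
`g^* = β_*π^*` with the identities above (§1.4–1.8), the algebraicity of the graph of `g^*` (§2.4), the
Hodge rigidity of the anchor, and the rational `Ψ`-matched Kähler frame.
-/

noncomputable section

-- the doubled component `HodgeConjecture.HodgeConjecture` is the summit/problem layout (D-0022), not a slip
set_option linter.dupNamespace false

namespace Summit.HodgeConjecture.HodgeConjecture.Theorems.NikulinSerreCarrier.NeronSeveriIntertwiner

open scoped BigOperators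
open CategoryTheory
open Literature.AlgebraicGeometry Literature.AlgebraicGeometry.HodgeTheory
open Literature.AlgebraicGeometry.Surfaces
open Literature.AlgebraicTopology.SingularHomology
open Summit.HodgeConjecture.HodgeConjecture.Theorems.NikulinTwinTransport

variable {X Y : Motives.SchemeOver ℂ}

/-! ### Marked generators of `H⁴` agree -/

/-- **Two MARKED integral generators of `H⁴(X(ℂ))` of a K3 surface coincide.** If `(φ₀, p₀)` and
`(φ, p)` are markings of `X` (integral classes `↔ ℤ²²`, `a ∪ b = (φ₀a.φ₀b) p₀ = (φa.φb) p`, `p₀, p` integral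
generators), then `p = p₀`: otherwise `p = −p₀` and `φ ∘ φ₀⁻¹` would be a rational anti-isometry of
`Λ_{K3} ⊗ ℚ`, which does not exist (signature `(3,19)`, `not_antiIsometry_k3Form`). So a marking pins its
generator to the orientation class. [cite: Huybrechts2016K3, Ch. 1 Prop. 3.5 and Ch. 14 §0.3 (vi)] -/
theorem generator_eq_of_markings (hX : IsK3Surface X)
    (φ₀ φ : complexBetti X (2 * 1) ≃ₗ[ℂ] (K3Index → ℂ)) (p₀ p : complexBetti X (2 * 2))
    (hgen₀ : ∀ q : complexBetti X (2 * 2), IsIntegralClass q → ∃ n : ℤ, q = n • p₀) (hp₀ : IsIntegralClass p₀)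
    (hint₀ : ∀ c : complexBetti X (2 * 1), IsIntegralClass c ↔ ∃ v : K3Index → ℤ, φ₀ c = fun i ↦ (v i : ℂ))
    (hcup₀ : ∀ a b : complexBetti X (2 * 1), cupProduct (rfl : 2 * 1 + 2 * 1 = 2 * 2) a b = k3Form (φ₀ a) (φ₀ b) • p₀)
    (hgen : ∀ q : complexBetti X (2 * 2), IsIntegralClass q → ∃ n : ℤ, q = n • p) (hp : IsIntegralClass p)
    (hint : ∀ c : complexBetti X (2 * 1), IsIntegralClass c ↔ ∃ v : K3Index → ℤ, φ c = fun i ↦ (v i : ℂ))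
    (hcup : ∀ a b : complexBetti X (2 * 1), cupProduct (rfl : 2 * 1 + 2 * 1 = 2 * 2) a b = k3Form (φ a) (φ b) • p) :
    p = p₀ := by
  have hp0 : p ≠ 0 := generator_ne_zero hX hgen
  have hp₀0 : p₀ ≠ 0 := generator_ne_zero hX hgen₀
  rcases eq_or_eq_neg_of_zsmul hp₀0 (hgen p₀ hp₀) (hgen₀ p hp) with h | h
  · exact h
  · exfalso
    -- `σ = φ ∘ φ₀⁻¹` is a rational anti-isometry of `Λ_ℂ`
    refine not_antiIsometry_k3Form (φ.toLinearMap ∘ₗ φ₀.symm.toLinearMap) (fun a b ↦ ?_) (fun v ↦ ?_)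
    · have h1 := hcup (φ₀.symm a) (φ₀.symm b)
      rw [hcup₀, φ₀.apply_symm_apply, φ₀.apply_symm_apply, h, smul_neg, ← neg_smul] at h1
      have h2 := sub_eq_zero.2 h1
      rw [← sub_smul, smul_eq_zero, sub_eq_zero] at h2
      rcases h2 with h2 | h2
      · simp only [LinearMap.coe_comp, LinearEquiv.coe_coe, Function.comp_apply]
        rw [h2, neg_neg]
      · exact absurd h2 hp₀0
    · have hv : IsIntegralClass (φ₀.symm fun i ↦ (v i : ℂ)) := (hint₀ _).2 ⟨v, φ₀.apply_symm_apply _⟩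
      obtain ⟨w, hw⟩ := (hint _).1 hv
      refine ⟨fun i ↦ (w i : ℚ), ?_⟩
      simp only [LinearMap.coe_comp, LinearEquiv.coe_coe, Function.comp_apply, hw, Rat.cast_intCast]

/-! ### Small K3 bookkeeping lemmas -/

/-- Under a marking the cup product on `H²` of a K3 surface is symmetric. [cite: Huybrechts2016K3, Ch. 1 Prop. 3.5] -/
theorem cupProduct_comm_of_marking (φ : complexBetti X (2 * 1) ≃ₗ[ℂ] (K3Index → ℂ)) (p : complexBetti X (2 * 2))
    (hcup : ∀ a b : complexBetti X (2 * 1), cupProduct (rfl : 2 * 1 + 2 * 1 = 2 * 2) a b = k3Form (φ a) (φ b) • p)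
    (a b : complexBetti X (2 * 1)) :
    cupProduct (rfl : 2 * 1 + 2 * 1 = 2 * 2) a b = cupProduct (rfl : 2 * 1 + 2 * 1 = 2 * 2) b a := by
  rw [hcup, hcup, k3Form_comm]

/-- The coefficient of a non-zero generator is determined. [folklore] -/
theorem smul_generator_injective {p : complexBetti X (2 * 2)} (hp : p ≠ 0) {a b : ℂ} (h : a • p = b • p) :
    a = b := by
  have h2 := sub_eq_zero.2 h
  rw [← sub_smul, smul_eq_zero, sub_eq_zero] at h2
  exact h2.resolve_right hp

/-- **The `(1,1)`-classes of a K3 surface form the submodule `⟨σ, σ̄⟩^⊥`** (for a non-zero `(2,0)`-class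
`σ`, granted `Huybrechts_K3_hodgeTypes_H2`): membership in the kernel of `(– ∪ σ, – ∪ σ̄)`.
[cite: Huybrechts2016K3, Ch. 6 Prop. 1.2 (iii)] -/
theorem isOfHodgeType_oneOne_iff_mem_ker (hHT : Huybrechts_K3_hodgeTypes_H2) (hX : IsK3Surface X)
    {σ : complexBetti X (2 * 1)} (hσ : IsOfHodgeType 2 X (2 * 1) 2 0 σ) (hσ0 : σ ≠ 0) (c : complexBetti X (2 * 1)) :
    IsOfHodgeType 2 X (2 * 1) 1 1 c ↔
      c ∈ LinearMap.ker ((cupProduct (rfl : 2 * 1 + 2 * 1 = 2 * 2)).flip σ) ⊓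
        LinearMap.ker ((cupProduct (rfl : 2 * 1 + 2 * 1 = 2 * 2)).flip
          (conjClass (Motives.ComplexPoints X) (2 * 1) σ)) := by
  rw [Submodule.mem_inf, LinearMap.mem_ker, LinearMap.mem_ker, LinearMap.flip_apply, LinearMap.flip_apply]
  exact (hHT X hX σ hσ hσ0).2.2 c

/-! ### The completed Nikulin similitude -/

/-- **The completed Nikulin similitude `Ψ = g^* ⊕ (N_j ↦ r_j)` on the summit carrier, from the quotient
correspondence.** Let `X, Y` be projective K3 surfaces, `ι` a Nikulin involution of `X`, `p, p'` MARKED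
integral generators of `H⁴(X(ℂ))`, `H⁴(Y(ℂ))` (each carried by a marking `H² ≅ Λ_ℂ`: integral classes
`↔ ℤ²²`, cup product `=` K3 form times the generator), and let `N_1, …, N_8 ∈ H²(Y(ℂ); ℂ)` and
`G : H²(Y(ℂ); ℂ) →ₗ H²(X(ℂ); ℂ)` be DATA satisfying the printed identities of the Nikulin quotient
`Y = \widetilde{X/ι}`, `G = g^* = β_*π^*` (van Geemen–Sarti §1.4–1.8, Prop. 2.5): the `N_j` are integral,
supported on divisors, of type `(1,1)`, with `N_i ∪ N_j = −2δ_ij p'`; `G` is rational, type-preserving, has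
`ι^*`-invariant values, and `Gx ∪ Gy = 2a p` whenever `x ∪ y = a p'` and `x, y ⊥ N_j`. Then, GRANTED the
named facts `Nikulin_involution_marking`, `Huybrechts_K3_marking_exists`, `Huybrechts_K3_hodgeTypes_H2`,
there are nodal coefficient functionals `ℓ_j` (`ℓ_j(y) p' = −½ (y ∪ N_j)`), an integral `ι^*`-anti-invariant
frame `r_j` (`r_i ∪ r_j = −4δ_ij p`, each `r_j` of type `(1,1)`) and the completed map
`Ψ y = G(y − Σ ℓ_j(y)N_j) + Σ ℓ_j(y) r_j` with:
`Ψ N_j = r_j`; `Ψ = G` on `N^⊥`; `Ψ` RATIONAL; `Ψ` TYPE-PRESERVING; `(x ∪ y) = a p' ⟹ (Ψx ∪ Ψy) = 2a p`;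
and every `ι^*`-anti-invariant class of `X` is `Ψ d` for some `d` in the span of the `N_j`, a class
supported on divisors of `Y`. [cite: VanGeemenSarti2007, §1.3, §1.8 and Prop. 2.5]
[cite: Huybrechts2016K3, Ch. 6 Prop. 1.2] -/
theorem exists_completedNikulinSimilitude (hNM : Nikulin_involution_marking)
    (hMk : Huybrechts_K3_marking_exists) (hHT : Huybrechts_K3_hodgeTypes_H2)
    (hX : IsK3Surface X) (hY : IsK3Surface Y) {ι : X ⟶ X} (hι : IsNikulinInvolution X ι)
    (p : complexBetti X (2 * 2)) (p' : complexBetti Y (2 * 2))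
    (hp : IsIntegralClass p ∧ ∀ q : complexBetti X (2 * 2), IsIntegralClass q → ∃ n : ℤ, q = n • p)
    (hp' : IsIntegralClass p' ∧ ∀ q : complexBetti Y (2 * 2), IsIntegralClass q → ∃ n : ℤ, q = n • p')
    (hpmk : ∃ φ₀ : complexBetti X (2 * 1) ≃ₗ[ℂ] (K3Index → ℂ),
      (∀ c : complexBetti X (2 * 1), IsIntegralClass c ↔ ∃ v : K3Index → ℤ, φ₀ c = fun i ↦ (v i : ℂ)) ∧
      ∀ a b : complexBetti X (2 * 1), cupProduct (rfl : 2 * 1 + 2 * 1 = 2 * 2) a b = k3Form (φ₀ a) (φ₀ b) • p)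
    (hp'mk : ∃ η₀ : complexBetti Y (2 * 1) ≃ₗ[ℂ] (K3Index → ℂ),
      (∀ c : complexBetti Y (2 * 1), IsIntegralClass c ↔ ∃ v : K3Index → ℤ, η₀ c = fun i ↦ (v i : ℂ)) ∧
      ∀ a b : complexBetti Y (2 * 1), cupProduct (rfl : 2 * 1 + 2 * 1 = 2 * 2) a b = k3Form (η₀ a) (η₀ b) • p')
    (N : Fin 8 → complexBetti Y (2 * 1)) (G : complexBetti Y (2 * 1) →ₗ[ℂ] complexBetti X (2 * 1))
    (hNint : ∀ j, IsIntegralClass (N j)) (hNalg : ∀ j, N j ∈ algebraicClasses Y 1)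
    (hN11 : ∀ j, IsOfHodgeType 2 Y (2 * 1) 1 1 (N j))
    (hNN : ∀ i j, cupProduct (rfl : 2 * 1 + 2 * 1 = 2 * 2) (N i) (N j) = (if i = j then (-2 : ℂ) else 0) • p')
    (hGrat : ∀ y, IsRationalClass y → IsRationalClass (G y))
    (hGtype : ∀ (i j : ℕ) (y : complexBetti Y (2 * 1)),
      IsOfHodgeType 2 Y (2 * 1) i j y → IsOfHodgeType 2 X (2 * 1) i j (G y))
    (hGinv : ∀ y, complexBetti.map ι (2 * 1) (G y) = G y)
    (hG2 : ∀ (x y : complexBetti Y (2 * 1)) (a : ℂ),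
      (∀ j, cupProduct (rfl : 2 * 1 + 2 * 1 = 2 * 2) x (N j) = 0) →
      (∀ j, cupProduct (rfl : 2 * 1 + 2 * 1 = 2 * 2) y (N j) = 0) →
        cupProduct (rfl : 2 * 1 + 2 * 1 = 2 * 2) x y = a • p' →
          cupProduct (rfl : 2 * 1 + 2 * 1 = 2 * 2) (G x) (G y) = ((2 : ℂ) * a) • p) :
    ∃ (ℓ : Fin 8 → complexBetti Y (2 * 1) →ₗ[ℂ] ℂ) (r : Fin 8 → complexBetti X (2 * 1))
      (Ψ : complexBetti Y (2 * 1) →ₗ[ℂ] complexBetti X (2 * 1)),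
      (∀ j y, ℓ j y • p' = -((2 : ℂ)⁻¹ • cupProduct (rfl : 2 * 1 + 2 * 1 = 2 * 2) y (N j))) ∧
      (∀ y, Ψ y = G (y - ∑ j, ℓ j y • N j) + ∑ j, ℓ j y • r j) ∧
      (∀ j, IsIntegralClass (r j)) ∧ (∀ j, complexBetti.map ι (2 * 1) (r j) = -r j) ∧
      (∀ i j, cupProduct (rfl : 2 * 1 + 2 * 1 = 2 * 2) (r i) (r j) = (if i = j then (-4 : ℂ) else 0) • p) ∧
      (∀ j, IsOfHodgeType 2 X (2 * 1) 1 1 (r j)) ∧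
      (∀ j, Ψ (N j) = r j) ∧
      (∀ y, (∀ j, cupProduct (rfl : 2 * 1 + 2 * 1 = 2 * 2) y (N j) = 0) → Ψ y = G y) ∧
      (∀ x, IsRationalClass x → IsRationalClass (Ψ x)) ∧
      (∀ (i j : ℕ) (x : complexBetti Y (2 * 1)),
        IsOfHodgeType 2 Y (2 * 1) i j x → IsOfHodgeType 2 X (2 * 1) i j (Ψ x)) ∧
      (∀ (x y : complexBetti Y (2 * 1)) (a : ℂ),
        cupProduct (rfl : 2 * 1 + 2 * 1 = 2 * 2) x y = a • p' →
          cupProduct (rfl : 2 * 1 + 2 * 1 = 2 * 2) (Ψ x) (Ψ y) = ((2 : ℂ) * a) • p) ∧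
      (∀ x : complexBetti X (2 * 1), complexBetti.map ι (2 * 1) x = -x →
        ∃ d ∈ Submodule.span ℂ (Set.range N), d ∈ algebraicClasses Y 1 ∧ Ψ d = x) := by
  classical
  -- markings: `η₀` of `Y` carrying `p'`; `φ₀` of `X` carrying `p`; the Nikulin marking `φ` with its frame
  obtain ⟨η₀, hη₀int, hη₀cup⟩ := hp'mk
  obtain ⟨φ₀, hφ₀int, hφ₀cup⟩ := hpmk
  obtain ⟨φ, pφ, r, ⟨hpφ, hgenφ, hφint, hφcup, hswap⟩, hrint, hranti, hrr, hrrcup, hrspan, hrorth⟩ :=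
    exists_antiInvariantFrame hNM hX hι
  -- the Nikulin marking carries the same generator `p`
  have hpeq : pφ = p := generator_eq_of_markings hX φ₀ φ p pφ hp.2 hp.1 hφ₀int hφ₀cup hgenφ hpφ hφint hφcup
  subst hpeq
  have hp0 : pφ ≠ 0 := generator_ne_zero hX hp.2
  have hp'0 : p' ≠ 0 := generator_ne_zero hY hp'.2
  -- the two cup forms as bilinear forms
  set BY : LinearMap.BilinForm ℂ (complexBetti Y (2 * 1)) := k3FormC.compl₁₂ η₀.toLinearMap η₀.toLinearMap
    with hBYdef
  set BX : LinearMap.BilinForm ℂ (complexBetti X (2 * 1)) := k3FormC.compl₁₂ φ.toLinearMap φ.toLinearMap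
    with hBXdef
  have hBY : ∀ a b, BY a b = k3Form (η₀ a) (η₀ b) := fun a b ↦ by simp [hBYdef]
  have hBX : ∀ a b, BX a b = k3Form (φ a) (φ b) := fun a b ↦ by simp [hBXdef]
  have hcupY : ∀ a b, cupProduct (rfl : 2 * 1 + 2 * 1 = 2 * 2) a b = BY a b • p' := fun a b ↦ by rw [hBY, hη₀cup]
  have hcupX : ∀ a b, cupProduct (rfl : 2 * 1 + 2 * 1 = 2 * 2) a b = BX a b • pφ := fun a b ↦ by rw [hBX, hφcup]
  -- `y ⊥ N_j` for the cup product iff for `BY`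
  have hperp_iff : ∀ y j, cupProduct (rfl : 2 * 1 + 2 * 1 = 2 * 2) y (N j) = 0 ↔ BY y (N j) = 0 := fun y j ↦ by
    rw [hcupY, smul_eq_zero, or_iff_left hp'0]
  -- the hypotheses of the linear algebra
  have hNB : ∀ i j, BY (N i) (N j) = if i = j then -2 else 0 := fun i j ↦
    smul_generator_injective hp'0 (by rw [← hcupY, hNN])
  have hNsymm : ∀ y j, BY (N j) y = BY y (N j) := fun y j ↦ by rw [hBY, hBY, k3Form_comm]
  have hrB : ∀ i j, BX (r i) (r j) = if i = j then -4 else 0 := fun i j ↦ by rw [hBX, hrr]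
  have hgB : ∀ x y, (∀ j, BY x (N j) = 0) → (∀ j, BY y (N j) = 0) → BX (G x) (G y) = 2 * BY x y := by
    intro x y hx hy
    refine smul_generator_injective hp0 ?_
    rw [← hcupX, hG2 x y (BY x y) (fun j ↦ (hperp_iff x j).2 (hx j)) (fun j ↦ (hperp_iff y j).2 (hy j))
      (hcupY x y)]
  have hgr : ∀ x j, (∀ k, BY x (N k) = 0) → BX (G x) (r j) = 0 := fun x j _ ↦ by
    rw [hBX]; exact (hrorth j (G x) (hGinv x)).2
  have hrg : ∀ x j, (∀ k, BY x (N k) = 0) → BX (r j) (G x) = 0 := fun x j _ ↦ by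
    rw [hBX]; exact (hrorth j (G x) (hGinv x)).1
  -- the completion
  obtain ⟨ℓ, Ψ, hℓ, hΨ⟩ := exists_completedSimilitude BY N G r
  have h2 : (2 : ℂ) ≠ 0 := two_ne_zero
  refine ⟨ℓ, r, Ψ, fun j y ↦ ?_, hΨ, hrint, hranti, hrrcup,
    fun j ↦ isOfHodgeType_oneOne_of_anti hNM hMk hHT hX hι (hranti j), map_nodal_of_formula hℓ hΨ hNB h2,
    fun y hy ↦ map_eq_of_perp_of_formula hℓ hΨ fun j ↦ (hperp_iff y j).1 (hy j), ?_, ?_, ?_, ?_⟩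
  · -- `ℓ_j(y) p' = −½ (y ∪ N_j)`
    rw [hℓ, hcupY, smul_smul, neg_smul]
  · -- rationality
    intro x hx
    refine map_preserves_of_formula hℓ hΨ IsRationalClass IsRationalClass (fun a b ha hb ↦ ha.add hb)
      (fun q a ha ↦ ha.smul q) IsRationalClass.zero (fun a b ha hb ↦ ha.add hb) (fun q a ha ↦ ha.smul q)
      hGrat (fun j ↦ (hNint j).isRationalClass) (fun j ↦ (hrint j).isRationalClass) ?_ hx
    intro y hy j
    obtain ⟨w, hw⟩ := (isRationalClass_iff_of_marking hY η₀ hη₀int y).1 hy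
    obtain ⟨v, hv⟩ := (hη₀int _).1 (hNint j)
    refine ⟨k3FormRat w fun i ↦ (v i : ℚ), ?_⟩
    rw [hBY, hw, hv, intCast_eq_ratCast_intCast, k3Form_ratCast]
  · -- Hodge types
    obtain ⟨σY, hσY0, hσY⟩ := hMk.exists_twoZero_ne_zero hY
    obtain ⟨σX, hσX0, hσX⟩ := hMk.exists_twoZero_ne_zero hX
    obtain ⟨hY20, hY02, hY11⟩ := hHT Y hY σY hσY hσY0
    -- the nodal classes are orthogonal to `σ_Y` and `σ̄_Y`
    have hNσ : ∀ j, cupProduct (rfl : 2 * 1 + 2 * 1 = 2 * 2) (N j) σY = 0 ∧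
        cupProduct (rfl : 2 * 1 + 2 * 1 = 2 * 2) (N j) (conjClass (Motives.ComplexPoints Y) (2 * 1) σY) = 0 :=
      fun j ↦ (hY11 (N j)).1 (hN11 j)
    intro i j x hx
    by_cases hij : i + j = 2 * 1
    · obtain ⟨rfl, rfl⟩ | ⟨rfl, rfl⟩ | ⟨rfl, rfl⟩ :
          (i = 2 ∧ j = 0) ∨ (i = 0 ∧ j = 2) ∨ (i = 1 ∧ j = 1) := by omega
      · -- `(2,0)`: `x = t σ_Y ⊥ N`, so `Ψ x = G x`
        obtain ⟨t, rfl⟩ := (hY20 x).1 hx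
        have hperp : ∀ k, cupProduct (rfl : 2 * 1 + 2 * 1 = 2 * 2) (t • σY) (N k) = 0 := fun k ↦ by
          rw [map_smul, LinearMap.smul_apply, cupProduct_comm_of_marking η₀ p' hη₀cup, (hNσ k).1, smul_zero]
        rw [map_eq_of_perp_of_formula hℓ hΨ fun k ↦ (hperp_iff _ k).1 (hperp k)]
        exact hGtype 2 0 _ hx
      · -- `(0,2)`: `x = t σ̄_Y ⊥ N`
        obtain ⟨t, rfl⟩ := (hY02 x).1 hx
        have hperp : ∀ k, cupProduct (rfl : 2 * 1 + 2 * 1 = 2 * 2)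
            (t • conjClass (Motives.ComplexPoints Y) (2 * 1) σY) (N k) = 0 := fun k ↦ by
          rw [map_smul, LinearMap.smul_apply, cupProduct_comm_of_marking η₀ p' hη₀cup, (hNσ k).2, smul_zero]
        rw [map_eq_of_perp_of_formula hℓ hΨ fun k ↦ (hperp_iff _ k).1 (hperp k)]
        exact hGtype 0 2 _ hx
      · -- `(1,1)`: the submodules `⟨σ, σ̄⟩^⊥`
        rw [isOfHodgeType_oneOne_iff_mem_ker hHT hX hσX hσX0]
        refine map_mem_of_formula hΨ _ _ (fun v hv ↦ ?_) (fun k ↦ ?_) (fun k ↦ ?_)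
          ((isOfHodgeType_oneOne_iff_mem_ker hHT hY hσY hσY0 x).1 hx)
        · exact (isOfHodgeType_oneOne_iff_mem_ker hHT hX hσX hσX0 _).1
            (hGtype 1 1 v ((isOfHodgeType_oneOne_iff_mem_ker hHT hY hσY hσY0 v).2 hv))
        · exact (isOfHodgeType_oneOne_iff_mem_ker hHT hY hσY hσY0 _).1 (hN11 k)
        · exact (isOfHodgeType_oneOne_iff_mem_ker hHT hX hσX hσX0 _).1
            (isOfHodgeType_oneOne_of_anti hNM hMk hHT hX hι (hranti k))
    · -- types `(i, j)` with `i + j ≠ 2` carry only `0`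
      obtain rfl := isOfHodgeType_eq_zero_of_add_ne hx hij
      rw [map_zero]
      obtain ⟨A⟩ := hX.nonempty_hodgeModel
      exact IsOfHodgeType.zero A _ _ _
  · -- the `2`-similitude clause
    intro x y a hxy
    have hB := bilin_map_map_of_formula (BW := BX) hℓ hΨ hNB h2 hNsymm hrB hgB hgr hrg x y
    have ha : BY x y = a := smul_generator_injective hp'0 (by rw [← hcupY, hxy])
    rw [hcupX, hB, ha]
  · -- anti-invariant classes come from the span of the nodal classes
    intro x hx
    obtain ⟨d, hd, hdx⟩ := exists_map_eq_of_mem_span_of_formula hℓ hΨ hNB h2 (hrspan x hx)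
    exact ⟨d, hd, (Submodule.span_le.2 (Set.range_subset_iff.2 hNalg)) hd, hdx⟩

/-- **Registered stub `stub_anchorCompletedNikulinSimilitude`** (crux item stmt-HodgeConjecture-14464, line
`neron-severi-intertwiner`, sub-goal of `stub_nikulinAnchorFrame`, fields `hp`/`hΨ`/`antiInvariant_from_divisors`
of `AnchorFrame`): the completed Nikulin similitude on the summit carrier from the quotient correspondence, granted
the three K3 facts — verbatim `exists_completedNikulinSimilitude`, with the registered one-line signature (fully
qualified names). [cite: VanGeemenSarti2007, §1.3, §1.8 and Prop. 2.5] [cite: Huybrechts2016K3, Ch. 6 Prop. 1.2] -/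
theorem stub_anchorCompletedNikulinSimilitude : open Literature.AlgebraicGeometry.Motives Literature.AlgebraicGeometry.HodgeTheory Literature.AlgebraicGeometry.Surfaces Literature.AlgebraicTopology.SingularHomology in ∀ {X Y : SchemeOver ℂ}, Nikulin_involution_marking → Huybrechts_K3_marking_exists → Huybrechts_K3_hodgeTypes_H2 → IsK3Surface X → IsK3Surface Y → ∀ {ι : X ⟶ X}, IsNikulinInvolution X ι → ∀ (p : complexBetti X (2 * 2)) (p' : complexBetti Y (2 * 2)), (IsIntegralClass p ∧ ∀ q : complexBetti X (2 * 2), IsIntegralClass q → ∃ n : ℤ, q = n • p) → (IsIntegralClass p' ∧ ∀ q : complexBetti Y (2 * 2), IsIntegralClass q → ∃ n : ℤ, q = n • p') → (∃ φ₀ : complexBetti X (2 * 1) ≃ₗ[ℂ] (K3Index → ℂ), (∀ c : complexBetti X (2 * 1), IsIntegralClass c ↔ ∃ v : K3Index → ℤ, φ₀ c = fun i ↦ (v i : ℂ)) ∧ ∀ a b : complexBetti X (2 * 1), cupProduct (rfl : 2 * 1 + 2 * 1 = 2 * 2) a b = k3Form (φ₀ a) (φ₀ b) • p) → (∃ η₀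 : complexBetti Y (2 * 1) ≃ₗ[ℂ] (K3Index → ℂ), (∀ c : complexBetti Y (2 * 1), IsIntegralClass c ↔ ∃ v : K3Index → ℤ, η₀ c = fun i ↦ (v i : ℂ)) ∧ ∀ a b : complexBetti Y (2 * 1), cupProduct (rfl : 2 * 1 + 2 * 1 = 2 * 2) a b = k3Form (η₀ a) (η₀ b) • p') → ∀ (N : Fin 8 → complexBetti Y (2 * 1)) (G : complexBetti Y (2 * 1) →ₗ[ℂ] complexBetti X (2 * 1)), (∀ j, IsIntegralClass (N j)) → (∀ j, N j ∈ algebraicClasses Y 1) → (∀ j, IsOfHodgeType 2 Y (2 * 1) 1 1 (N j)) → (∀ i j, cupProduct (rfl : 2 * 1 + 2 * 1 = 2 * 2) (N i) (N j) = (if i = j then (-2 : ℂ) else 0) • p') → (∀ y, IsRationalClass y → IsRationalClass (G y)) → (∀ (i j : ℕ) (y : complexBetti Y (2 * 1)), IsOfHodgeType 2 Y (2 * 1) i j y → IsOfHodgeType 2 X (2 * 1) i j (G y)) → (∀ y, complexBetti.map ι (2 * 1) (G y) = G y) → (∀ (x y : complexBetti Y (2 * 1)) (a : ℂ), (∀ j,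 cupProduct (rfl : 2 * 1 + 2 * 1 = 2 * 2) x (N j) = 0) → (∀ j, cupProduct (rfl : 2 * 1 + 2 * 1 = 2 * 2) y (N j) = 0) → cupProduct (rfl : 2 * 1 + 2 * 1 = 2 * 2) x y = a • p' → cupProduct (rfl : 2 * 1 + 2 * 1 = 2 * 2) (G x) (G y) = ((2 : ℂ) * a) • p) → ∃ (ℓ : Fin 8 → complexBetti Y (2 * 1) →ₗ[ℂ] ℂ) (r : Fin 8 → complexBetti X (2 * 1)) (Ψ : complexBetti Y (2 * 1) →ₗ[ℂ] complexBetti X (2 * 1)), (∀ j y, ℓ j y • p' = -((2 : ℂ)⁻¹ • cupProduct (rfl : 2 * 1 + 2 * 1 = 2 * 2) y (N j))) ∧ (∀ y, Ψ y = G (y - ∑ j, ℓ j y • N j) + ∑ j, ℓ j y • r j) ∧ (∀ j, IsIntegralClass (r j)) ∧ (∀ j, complexBetti.map ι (2 * 1) (r j) = -r j) ∧ (∀ i j, cupProduct (rfl : 2 * 1 + 2 * 1 = 2 * 2) (r i) (r j) = (if i = j then (-4 : ℂ) else 0) • p) ∧ (∀ j, IsOfHodgeType 2 X (2 * 1) 1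 1 (r j)) ∧ (∀ j, Ψ (N j) = r j) ∧ (∀ y, (∀ j, cupProduct (rfl : 2 * 1 + 2 * 1 = 2 * 2) y (N j) = 0) → Ψ y = G y) ∧ (∀ x, IsRationalClass x → IsRationalClass (Ψ x)) ∧ (∀ (i j : ℕ) (x : complexBetti Y (2 * 1)), IsOfHodgeType 2 Y (2 * 1) i j x → IsOfHodgeType 2 X (2 * 1) i j (Ψ x)) ∧ (∀ (x y : complexBetti Y (2 * 1)) (a : ℂ), cupProduct (rfl : 2 * 1 + 2 * 1 = 2 * 2) x y = a • p' → cupProduct (rfl : 2 * 1 + 2 * 1 = 2 * 2) (Ψ x) (Ψ y) = ((2 : ℂ) * a) • p) ∧ (∀ x : complexBetti X (2 * 1), complexBetti.map ι (2 * 1) x = -x → ∃ d ∈ Submodule.span ℂ (Set.range N), d ∈ algebraicClasses Y 1 ∧ Ψ d = x) :=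
  fun hNM hMk hHT hX hY _ hι p p' hp hp' hpmk hp'mk N G hNint hNalg hN11 hNN hGrat hGtype hGinv hG2 ↦
    exists_completedNikulinSimilitude hNM hMk hHT hX hY hι p p' hp hp' hpmk hp'mk N G hNint hNalg hN11 hNN hGrat
      hGtype hGinv hG2

end Summit.HodgeConjecture.HodgeConjecture.Theorems.NikulinSerreCarrier.NeronSeveriIntertwiner

end
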